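import Mathlib
import Summits.KontsevichZagierPeriods.Zeta5Search.RVBaileyShallow
import Summits.KontsevichZagierPeriods.Zeta5Search.WedgeDictionaryLevelDescentFaceU
import HarnessLib

/-!
# ζ(5) search — PROOF of the deep ↦ shallow law for the Bailey maps (`RVBailey.BaileyShallowLaw`)

Cell `pub-zeta5` (HONEST FRAMING: systematic search; no irrationality claim unless certified), family RV
(Rhin–Viola-type group refinements), generation 2.  `Zeta5Search/RVBaileyShallow.lean` (gen 1) recorded as a
`@[conjecture]` the exhaustively OBSERVED law: on the Brown–Zudilin polytope `0 ≤ 2b_l ≤ b₀`, slices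
`d(b) = 3b₀ − Σb_l ∈ {−1, 0}`, every Bailey map `T_S` (`S = {i<j<k} ⊂ {1..7}`, the `W(E₇) ∖ S₇` generators acting on
the parameters of Brown–Zudilin's dual very-well-poised series (34)) with `Δ_S(b) ≠ 0` and non-negative image sends
`b` to a point carrying NO `ζ(5)` (`U(T_S b) = 0`), and on Bailey's balanced slice `d = −1` even to a rational point
(`W(T_S b) = 0`).  THIS FILE PROVES IT (`baileyShallowLaw_holds : BaileyShallowLaw`), with no numerics and no cited
fact; nothing here concerns irrationality.

## The mechanism (pole-order collapse)

In the coordinate `y = t + 1` the summand of (34) is `R_b(y) = numPoly_b(y) / ∏_{s=0}^{b₀} (y+s)^6`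
(`DualSeries.term_eq`), and the canonical coefficients are sums of partial-fraction coefficients at the poles
`y = −q`: `U(b) = Σ_q c_{4,q}`, `W(b) = Σ_q c_{2,q}` (`WedgeDictionary.coeffU_eq/coeffW_eq`).

* ALGEBRA (`pf_coeff_eq_zero_of_dvd`).  If `(X+q)^k ∣ numPoly_b` (`k ≤ 6`) then `c_{o,q} = 0` for `o ≥ 6 − k`:
  the pole at `−q` has order `≤ 6 − k`.  (From the tree's Taylor congruence `BigPrime.taylor_numPoly_congr`
  `numPoly_b(X − q) ≡ (Σ_o c_{o,q} X^{5−o})·E_q (mod X^6)` and `E_q(0) ≠ 0`.)  Hence (`coeffU_eq_zero_of_sq_dvd`,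
  `coeffW_eq_zero_of_pow_four_dvd`): double roots of `numPoly_b` at every pole kill `U`, quadruple roots kill `W`;
  with the covering count below this is the DEPTH CRITERION `coeffU_eq_zero_of_coverCount` (`N_b ≥ 2` pointwise
  ⇒ `U(b) = 0`) / `coeffW_eq_zero_of_coverCount` (`N_b ≥ 4` ⇒ `W(b) = U(b) = 0`), valid for every admissible `b`.
* COVERING (`pow_coverCount_dvd_numPoly`).  Slot `l` of `numPoly_b = (2X+b₀) ∏_l (X)_{b_l} (X + b₀−b_l+1)_{b_l}`
  vanishes at `−q` once if `q < b_l` and once if `q > b₀ − b_l`; so `(X+q)^{N_b(q)} ∣ numPoly_b` with the covering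
  count `N_b(q) = Σ_l ([q < b_l] + [b₀ − q < b_l])` (`coverCount`).
* COUNTING (`four_cover`, `cover_baileyT`).  For `b' = T_S b` the FOUR slots NOT in `S` keep their parameters
  `y = b_l` with `2y ≤ b₀ =: M`, while the new leading parameter is `B = b₀ + Δ ≤ M − 1` (`Δ ≤ −1` on both slices,
  gen 1) and `Σ_{l ∉ S} b_l = B + M − d`.  An elementary inequality on four integers (`four_cover`, linear
  arithmetic after case split) then gives `N_{b'}(q) ≥ 3` for every `q`, and `≥ 4` when `d = −1` — uniformly in `q`,
  using the untouched slots only.  So every pole of `R_{T_S b}` has order `≤ 3` (no `ζ(5)`, indeed no `ζ(4), ζ(5)`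
  terms before parity), and order `≤ 2` on the balanced slice (only `ζ(2)`-and-below terms, killed by well-poised
  parity: `W = 0`).

RV reading (FAMILY.md §12): the `W(E₇) ∖ S₇` Bailey maps never relate two `ζ(5)`-carrying points of the polytope
slices — PROVED; the arithmetic group of the BZ cell on these slices is exactly `S₇` (gen 1's coset lemma gives the
other half).
-/

noncomputable section

open Finset Polynomial

namespace Summit.KontsevichZagierPeriods.Zeta5Search.RVBailey

open Summit.KontsevichZagierPeriods.Zeta5Search.DualSeries
open Summit.KontsevichZagierPeriods.Zeta5Search.WedgeDictionary
open Summit.KontsevichZagierPeriods.Zeta5Search.BigPrime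
open Literature.NumberTheory.Transcendental.BallRivoal (pochPoly)

/-! ### 1. Algebra: partial-fraction coefficients below the root multiplicity vanish -/

/-- If `X^k ∣ S·E` in `ℚ[X]` and `E(0) ≠ 0`, then the coefficients of `S` of degree `< k` vanish. -/
theorem coeff_eq_zero_of_X_pow_dvd_mul {S E : ℚ[X]} {k : ℕ} (h : X ^ k ∣ S * E) (hE : E.coeff 0 ≠ 0) :
    ∀ i, i < k → S.coeff i = 0 := by
  intro i
  induction i using Nat.strong_induction_on with
  | _ i ih =>
    intro hi
    have hc : (S * E).coeff i = 0 := (X_pow_dvd_iff.1 h) i hi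
    rw [coeff_mul, Finset.Nat.sum_antidiagonal_eq_sum_range_succ_mk, sum_range_succ, Nat.sub_self] at hc
    have hz : ∑ j ∈ range i, S.coeff j * E.coeff (i - j) = 0 :=
      sum_eq_zero fun j hj => by
        rw [ih j (mem_range.1 hj) (lt_trans (mem_range.1 hj) hi), zero_mul]
    rw [hz, zero_add] at hc
    exact (mul_eq_zero.1 hc).resolve_right hE

/-- `(X + q)^k ∣ f` implies `X^k ∣ f(X − q)`. -/
theorem X_pow_dvd_taylor_of_dvd {f : ℚ[X]} {q : ℚ} {k : ℕ} (h : (X + C q) ^ k ∣ f) :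
    X ^ k ∣ taylor (-q) f := by
  obtain ⟨g, rfl⟩ := h
  rw [taylor_mul, taylor_pow, taylor_X_add_C, add_neg_cancel, C_0, add_zero]
  exact dvd_mul_right _ _

/-- **Pole order drops with the root multiplicity of the numerator.**  For partial-fraction data `c` of `R_b` and a
pole index `q ≤ b₀`: if `(X+q)^k ∣ numPoly_b` (`k ≤ 6`) then `c_{5−i, q} = 0` for all `i < k`, i.e. `c_{o,q} = 0`
for `o ≥ 6 − k` — the pole of `R_b` at `y = −q` has order at most `6 − k`. -/
theorem pf_coeff_eq_zero_of_dvd (b : ℕ → ℤ) {c : ℕ → ℕ → ℚ} (hc : IsPFData b c) {q : ℕ}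
    (hq : q ≤ (b 0).toNat) {k : ℕ} (hk : k ≤ 6) (hdiv : (X + C (q : ℚ)) ^ k ∣ numPoly b) :
    ∀ i, i < k → c (5 - i) q = 0 := by
  have h1 := taylor_numPoly_congr b hc hq
  have hT : X ^ k ∣ taylor (-(q : ℚ)) (numPoly b) := X_pow_dvd_taylor_of_dvd hdiv
  have hSE : X ^ k ∣ (∑ o ∈ range 6, C (c o q) * X ^ (5 - o)) * ER ℚ (b 0).toNat q := by
    have h2 := (pow_dvd_pow X hk).trans h1
    have h3 := dvd_sub hT h2
    rwa [sub_sub_cancel] at h3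
  have he0 : (ER ℚ (b 0).toNat q).coeff 0 = ((e0Z (b 0).toNat q : ℤ) : ℚ) := by
    rw [← ER_map (Int.castRingHom ℚ), coeff_map, ER_coeff_zero]; simp
  have he0' : (ER ℚ (b 0).toNat q).coeff 0 ≠ 0 := by
    rw [he0]; exact_mod_cast e0Z_ne_zero _ _
  intro i hi
  rw [← LevelDescent.coeff_S c q i (by omega)]
  exact coeff_eq_zero_of_X_pow_dvd_mul hSE he0' i hi

/-! ### 2. `U = 0` under double roots, `W = 0` under quadruple roots -/

/-- If `numPoly_b` has at least a double root at every pole `−q`, `q ≤ b₀`, then `U(b) = 0`. -/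
theorem coeffU_eq_zero_of_sq_dvd (b : ℕ → ℤ) (hb : InBox b)
    (hsum : ∑ j ∈ range 7, b (j + 1) ≤ 3 * b 0 + 1)
    (h2 : ∀ q : ℕ, q ≤ (b 0).toNat → (X + C (q : ℚ)) ^ 2 ∣ numPoly b) : coeffU b = 0 := by
  obtain ⟨c, hc⟩ := exists_isPFData b hb hsum
  rw [coeffU_eq hc]
  refine sum_eq_zero fun q hq => ?_
  have hq' : q ≤ (b 0).toNat := Nat.lt_succ_iff.1 (mem_range.1 hq)
  exact pf_coeff_eq_zero_of_dvd b hc hq' (by norm_num) (h2 q hq') 1 (by norm_num)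

/-- If `numPoly_b` has at least a quadruple root at every pole `−q`, `q ≤ b₀`, then `W(b) = 0`. -/
theorem coeffW_eq_zero_of_pow_four_dvd (b : ℕ → ℤ) (hb : InBox b)
    (hsum : ∑ j ∈ range 7, b (j + 1) ≤ 3 * b 0 + 1)
    (h4 : ∀ q : ℕ, q ≤ (b 0).toNat → (X + C (q : ℚ)) ^ 4 ∣ numPoly b) : coeffW b = 0 := by
  obtain ⟨c, hc⟩ := exists_isPFData b hb hsum
  rw [coeffW_eq hc]
  refine sum_eq_zero fun q hq => ?_
  have hq' : q ≤ (b 0).toNat := Nat.lt_succ_iff.1 (mem_range.1 hq)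
  exact pf_coeff_eq_zero_of_dvd b hc hq' (by norm_num) (h4 q hq') 3 (by norm_num)

/-! ### 3. Covering: each slot contributes its incidences as linear factors of the numerator -/

/-- Incidence count of the pole index `q` in a slot with lower parameter `y` and leading parameter `B`:
`[q < y] + [B − q < y]` (the factor `(X)_y` vanishes at `−q` iff `q < y`, the factor `(X + B−y+1)_y` iff `q > B − y`). -/
def slotInc (B q y : ℤ) : ℕ := (if q < y then 1 else 0) + (if B - q < y then 1 else 0)

/-- The covering count `N_b(q) = Σ_{l=1}^{7} slotInc(b₀, q, b_l)`. -/
def coverCount (b : ℕ → ℤ) (q : ℤ) : ℕ := ∑ l ∈ range 7, slotInc (b 0) q (b (l + 1))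

/-- One slot: `(X+q)^{slotInc(B,q,y)}` divides `(X)_y · (X + B−y+1)_y` (`0 ≤ y`, `q ≤ B`). -/
theorem slot_dvd (B y : ℤ) (hy : 0 ≤ y) (q : ℕ) (hqB : (q : ℤ) ≤ B) :
    (X + C (q : ℚ)) ^ slotInc B q y ∣ pochPoly 0 y.toNat * pochPoly ((B - y + 1 : ℤ) : ℚ) y.toNat := by
  have hyN : ((y.toNat : ℕ) : ℤ) = y := Int.toNat_of_nonneg hy
  have hlow : (q : ℤ) < y → (X + C (q : ℚ)) ∣ pochPoly 0 y.toNat := fun h => by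
    have hmem : q ∈ range y.toNat := mem_range.2 (by omega)
    have e : (X + C (q : ℚ) : ℚ[X]) = X + C ((0 : ℚ) + ((q : ℕ) : ℚ)) := by rw [zero_add]
    unfold pochPoly
    rw [e]
    exact dvd_prod_of_mem (fun s : ℕ => (X + C ((0 : ℚ) + (s : ℚ)) : ℚ[X])) hmem
  have hup : B - q < y → (X + C (q : ℚ)) ∣ pochPoly ((B - y + 1 : ℤ) : ℚ) y.toNat := fun h => by
    obtain ⟨s, hs⟩ : ∃ s : ℕ, (s : ℤ) = q - (B - y + 1) :=
      ⟨(q - (B - y + 1)).toNat, Int.toNat_of_nonneg (by omega)⟩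
    have hmem : s ∈ range y.toNat := mem_range.2 (by omega)
    have hsQ : ((B - y + 1 : ℤ) : ℚ) + (s : ℚ) = (q : ℚ) := by
      have : ((B - y + 1 : ℤ) : ℚ) + ((s : ℤ) : ℚ) = ((q : ℤ) : ℚ) := by rw [hs]; push_cast; ring
      exact_mod_cast this
    have e : (X + C (q : ℚ) : ℚ[X]) = X + C (((B - y + 1 : ℤ) : ℚ) + (s : ℚ)) := by rw [hsQ]
    unfold pochPoly
    rw [e]
    exact dvd_prod_of_mem (fun s' : ℕ => (X + C (((B - y + 1 : ℤ) : ℚ) + (s' : ℚ)) : ℚ[X])) hmem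
  by_cases h1 : (q : ℤ) < y <;> by_cases h2 : B - q < y <;>
    simp only [slotInc, h1, h2, if_true, if_false, Nat.reduceAdd, add_zero, zero_add, pow_one, pow_zero,
      one_dvd]
  · rw [pow_two]
    exact mul_dvd_mul (hlow h1) (hup h2)
  · exact dvd_mul_of_dvd_left (hlow h1) _
  · exact dvd_mul_of_dvd_right (hup h2) _

/-- **`(X+q)^{N_b(q)} ∣ numPoly_b`** for `q ≤ b₀` (all lower parameters non-negative). -/
theorem pow_coverCount_dvd_numPoly (b : ℕ → ℤ) (hpos : ∀ l ∈ range 7, 0 ≤ b (l + 1)) (q : ℕ)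
    (hqB : (q : ℤ) ≤ b 0) : (X + C (q : ℚ)) ^ coverCount b q ∣ numPoly b := by
  rw [coverCount, ← prod_pow_eq_pow_sum, numPoly]
  exact Dvd.dvd.mul_left
    (prod_dvd_prod_of_dvd _ _ fun l hl => slot_dvd (b 0) (b (l + 1)) (hpos l hl) q hqB) _

/-- **Depth criterion for `ζ(5)`** (any admissible `b`): if every pole index `q ≤ b₀` is covered at least twice
(`N_b(q) ≥ 2`), then `U(b) = 0` — the point carries no `ζ(5)`. -/
theorem coeffU_eq_zero_of_coverCount (b : ℕ → ℤ) (hb : InBox b)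
    (hsum : ∑ j ∈ range 7, b (j + 1) ≤ 3 * b 0 + 1)
    (h : ∀ q : ℕ, q ≤ (b 0).toNat → 2 ≤ coverCount b q) : coeffU b = 0 := by
  have h0 : (((b 0).toNat : ℕ) : ℤ) = b 0 := Int.toNat_of_nonneg hb.1
  exact coeffU_eq_zero_of_sq_dvd b hb hsum fun q hq =>
    (pow_dvd_pow _ (h q hq)).trans (pow_coverCount_dvd_numPoly b (fun l hl => (hb.2 l hl).1) q (by omega))

/-- **Depth criterion for `ζ(3)`** (any admissible `b`): if every pole index `q ≤ b₀` is covered at least four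
times (`N_b(q) ≥ 4`), then `W(b) = 0` (and `U(b) = 0`): the value `F̃₇(b)` is rational. -/
theorem coeffW_eq_zero_of_coverCount (b : ℕ → ℤ) (hb : InBox b)
    (hsum : ∑ j ∈ range 7, b (j + 1) ≤ 3 * b 0 + 1)
    (h : ∀ q : ℕ, q ≤ (b 0).toNat → 4 ≤ coverCount b q) : coeffW b = 0 ∧ coeffU b = 0 := by
  have h0 : (((b 0).toNat : ℕ) : ℤ) = b 0 := Int.toNat_of_nonneg hb.1
  refine ⟨coeffW_eq_zero_of_pow_four_dvd b hb hsum fun q hq =>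
    (pow_dvd_pow _ (h q hq)).trans (pow_coverCount_dvd_numPoly b (fun l hl => (hb.2 l hl).1) q (by omega)),
    coeffU_eq_zero_of_coverCount b hb hsum fun q hq => le_trans (by norm_num) (h q hq)⟩

/-! ### 4. Counting: the four untouched slots cover every pole three (resp. four) times -/

/-- **Four-integer covering lemma.**  If `2yₜ ≤ M` (`t = 1..4`), `B + 1 ≤ M`, `d ∈ {0, −1}` and
`y₁ + y₂ + y₃ + y₄ = B + M − d`, then for every `q` the incidences `Σₜ ([q < yₜ] + [B − q < yₜ])` number at least
`3`, and at least `4` when `d = −1`.  (Linear arithmetic after the `2⁸` case split.) -/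
theorem four_cover (B M d q y₁ y₂ y₃ y₄ : ℤ) (hM : B + 1 ≤ M) (hd : d = 0 ∨ d = -1)
    (h1 : 2 * y₁ ≤ M) (h2 : 2 * y₂ ≤ M) (h3 : 2 * y₃ ≤ M) (h4 : 2 * y₄ ≤ M)
    (hsum : y₁ + y₂ + y₃ + y₄ = B + M - d) :
    3 ≤ slotInc B q y₁ + slotInc B q y₂ + slotInc B q y₃ + slotInc B q y₄ ∧
      (d = -1 → 4 ≤ slotInc B q y₁ + slotInc B q y₂ + slotInc B q y₃ + slotInc B q y₄) := by
  unfold slotInc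
  split_ifs <;> omega

/-- The four-integer lemma on a four-element index set. -/
theorem cover_finset (F : Finset ℕ) (hF : F.card = 4) (y : ℕ → ℤ) (B M d q : ℤ) (hM : B + 1 ≤ M)
    (hd : d = 0 ∨ d = -1) (hcap : ∀ l ∈ F, 2 * y l ≤ M) (hsum : ∑ l ∈ F, y l = B + M - d) :
    3 ≤ ∑ l ∈ F, slotInc B q (y l) ∧ (d = -1 → 4 ≤ ∑ l ∈ F, slotInc B q (y l)) := by
  obtain ⟨a, t, hat, rfl, ht⟩ := card_eq_succ.1 hF
  obtain ⟨x, w, z, hxw, hxz, hwz, rfl⟩ := card_eq_three.1 ht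
  have hx : x ∉ ({w, z} : Finset ℕ) := by simp [hxw, hxz]
  have hw : w ∉ ({z} : Finset ℕ) := by simp [hwz]
  rw [sum_insert hat, sum_insert hx, sum_insert hw, sum_singleton] at hsum ⊢
  have ha' := hcap a (mem_insert_self _ _)
  have hx' := hcap x (by simp)
  have hw' := hcap w (by simp)
  have hz' := hcap z (by simp)
  have h := four_cover B M d q (y a) (y x) (y w) (y z) hM hd ha' hx' hw' hz' (by linarith)
  omega

/-- The index set (`l ∈ range 7`, standing for `b_{l+1}`) of the four slots NOT touched by `T_{ijk}`. -/
def untouched (i j k : ℕ) : Finset ℕ := (range 7).filter fun l => ¬(l + 1 = i ∨ l + 1 = j ∨ l + 1 = k)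

/-- There are four untouched slots. -/
theorem untouched_card (i j k : ℕ) (hi : 1 ≤ i) (hij : i < j) (hjk : j < k) (hk : k ≤ 7) :
    (untouched i j k).card = 4 := by
  have hi' : i ≤ 5 := by omega
  have hj' : j ≤ 6 := by omega
  interval_cases i <;> interval_cases j <;> interval_cases k <;> decide

/-- Sum over the untouched slots = total − the three touched ones. -/
theorem sum_untouched (i j k : ℕ) (hi : 1 ≤ i) (hij : i < j) (hjk : j < k) (hk : k ≤ 7) (f : ℕ → ℤ) :
    ∑ l ∈ untouched i j k, f (l + 1) = (∑ l ∈ range 7, f (l + 1)) - f i - f j - f k := by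
  have hi' : i ≤ 5 := by omega
  have hj' : j ≤ 6 := by omega
  interval_cases i <;> interval_cases j <;> interval_cases k <;>
    (simp only [untouched, sum_filter, sum_range_succ, sum_range_zero]; norm_num; omega)

/-- On both slices a non-trivial Bailey map has `Δ ≤ −1`. -/
theorem baileyDelta_le_neg_one (b : ℕ → ℤ) (hP : ∀ l ∈ range 7, 0 ≤ b (l + 1) ∧ 2 * b (l + 1) ≤ b 0)
    (hd : dOf b = -1 ∨ dOf b = 0) (i j k : ℕ) (hi : 1 ≤ i) (hij : i < j) (hjk : j < k) (hk : k ≤ 7)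
    (hΔ : baileyDelta i j k b ≠ 0) : baileyDelta i j k b ≤ -1 := by
  rcases hd with hd | hd
  · exact baileyDelta_le_of_balanced b hP hd i j k hi hij hjk hk
  · have := baileyDelta_nonpos_of_dOf_zero b hP hd i j k hi hij hjk hk; omega

/-- **Covering count of a Bailey image.**  On the polytope slices `d ∈ {−1, 0}`, for a non-trivial Bailey map,
`N_{T_S b}(q) ≥ 3` for every `q`, and `≥ 4` when `d = −1` (the untouched slots suffice). -/
theorem cover_baileyT (b : ℕ → ℤ) (i j k : ℕ) (hP : ∀ l ∈ range 7, 0 ≤ b (l + 1) ∧ 2 * b (l + 1) ≤ b 0)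
    (hi : 1 ≤ i) (hij : i < j) (hjk : j < k) (hk : k ≤ 7) (hd : dOf b = -1 ∨ dOf b = 0)
    (hΔ : baileyDelta i j k b ≠ 0) (q : ℤ) :
    3 ≤ coverCount (baileyT i j k b) q ∧ (dOf b = -1 → 4 ≤ coverCount (baileyT i j k b) q) := by
  have hΔ1 := baileyDelta_le_neg_one b hP hd i j k hi hij hjk hk hΔ
  have hsub : untouched i j k ⊆ range 7 := filter_subset _ _
  have hB : baileyT i j k b 0 = b 0 + baileyDelta i j k b := baileyT_zero i j k b
  have heq : ∀ l ∈ untouched i j k, baileyT i j k b (l + 1) = b (l + 1) := fun l hl => by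
    have hl' := (mem_filter.1 hl).2
    have hc : ¬(l + 1 = 0 ∨ l + 1 = i ∨ l + 1 = j ∨ l + 1 = k) := by omega
    show (if l + 1 = 0 ∨ l + 1 = i ∨ l + 1 = j ∨ l + 1 = k then b (l + 1) + baileyDelta i j k b
      else b (l + 1)) = b (l + 1)
    rw [if_neg hc]
  have hle : ∑ l ∈ untouched i j k, slotInc (b 0 + baileyDelta i j k b) q (b (l + 1)) ≤
      coverCount (baileyT i j k b) q := by
    unfold coverCount
    calc ∑ l ∈ untouched i j k, slotInc (b 0 + baileyDelta i j k b) q (b (l + 1))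
        = ∑ l ∈ untouched i j k, slotInc (baileyT i j k b 0) q (baileyT i j k b (l + 1)) :=
          sum_congr rfl fun l hl => by rw [heq l hl, hB]
      _ ≤ ∑ l ∈ range 7, slotInc (baileyT i j k b 0) q (baileyT i j k b (l + 1)) :=
          sum_le_sum_of_subset hsub
  have hcap : ∀ l ∈ untouched i j k, 2 * b (l + 1) ≤ b 0 := fun l hl => (hP l (hsub hl)).2
  have hsum : ∑ l ∈ untouched i j k, b (l + 1) = (b 0 + baileyDelta i j k b) + b 0 - dOf b := by
    rw [sum_untouched i j k hi hij hjk hk b, dOf, baileyDelta]; ring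
  have h4 := cover_finset (untouched i j k) (untouched_card i j k hi hij hjk hk) (fun l => b (l + 1))
    (b 0 + baileyDelta i j k b) (b 0) (dOf b) q (by omega) hd.symm hcap hsum
  omega

/-! ### 5. The theorem -/

/-- **The deep ↦ shallow law holds** (proof of the `@[conjecture]` `BaileyShallowLaw` of
`Zeta5Search/RVBaileyShallow.lean`): for `b` in the Brown–Zudilin polytope `0 ≤ 2b_l ≤ b₀` with
`d(b) ∈ {−1, 0}` and a Bailey map `T_S` with `Δ_S(b) ≠ 0` and non-negative image, `U(T_S b) = 0`, and
`W(T_S b) = 0` when `d(b) = −1`. -/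
theorem baileyShallowLaw_holds : BaileyShallowLaw := by
  intro b i j k hb0 hP hi hij hjk hk hd hΔ hadm
  have hΔ1 := baileyDelta_le_neg_one b hP hd i j k hi hij hjk hk hΔ
  have hPi : ∀ l, 1 ≤ l → l ≤ 7 → 0 ≤ b l ∧ 2 * b l ≤ b 0 := fun l h1 h7 => by
    have := hP (l - 1) (mem_range.2 (by omega))
    rwa [show l - 1 + 1 = l by omega] at this
  have hbi := hPi i hi (by omega)
  have hbj := hPi j (by omega) (by omega)
  have hbk := hPi k (by omega) hk
  have hB : baileyT i j k b 0 = b 0 + baileyDelta i j k b := baileyT_zero i j k b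
  have hΔlow : -b 0 ≤ 2 * baileyDelta i j k b := by
    simp only [baileyDelta]; omega
  -- the image lies in the box and has excess `d ≥ −1`
  have hbox : InBox (baileyT i j k b) := by
    refine ⟨hadm 0, fun l hl => ⟨hadm (l + 1), ?_⟩⟩
    have hPl := hP l hl
    rw [hB]
    show (if l + 1 = 0 ∨ l + 1 = i ∨ l + 1 = j ∨ l + 1 = k then b (l + 1) + baileyDelta i j k b
      else b (l + 1)) ≤ b 0 + baileyDelta i j k b + 1
    by_cases hc : (l + 1 = 0 ∨ l + 1 = i ∨ l + 1 = j ∨ l + 1 = k)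
    · rw [if_pos hc]; omega
    · rw [if_neg hc]; omega
  have hsum : ∑ l ∈ range 7, baileyT i j k b (l + 1) ≤ 3 * baileyT i j k b 0 + 1 := by
    have h1 := dOf_baileyT i j k hi hij hjk hk b
    rw [dOf] at h1
    omega
  -- every pole is covered `N(q) ≥ 3` times (`≥ 4` on the balanced slice): apply the depth criteria
  have hcov := fun q : ℕ => cover_baileyT b i j k hP hi hij hjk hk hd hΔ (q : ℤ)
  exact ⟨coeffU_eq_zero_of_coverCount _ hbox hsum fun q _ => le_trans (by norm_num) (hcov q).1,
    fun hd1 => (coeffW_eq_zero_of_coverCount _ hbox hsum fun q _ => (hcov q).2 hd1).1⟩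

end Summit.KontsevichZagierPeriods.Zeta5Search.RVBailey
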